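import Summits.BirchSwinnertonDyer.BirchSwinnertonDyer.Theorems.SignedLowerHalvesKobayashiLowerHalfLargeImageCartanField
import Mathlib.NumberTheory.LegendreSymbol.JacobiSymbol
import HarnessLib

/-!
# Triage evidence (crux-triage r1-1, gen 10) for crux 3 `KobayashiLowerHalfLargeImage`
(item `stmt-BirchSwinnertonDyer-19001`), idea / line `lower-chamber-door`

CHEAP ATTACK (v) «`Leans on:` — are the named things as strong as used?», run at the KERNEL:
the side-condition stub `stub_defField : DefFieldStatement` of the published (unregistered) line
`Cruxes/KobayashiLowerHalfLargeImage/Lines/lower_chamber_door.lean` (`stub_defField` l.134, statement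
l.72–74, `IsDefConfig` l.57–60) is DISCHARGED below, sorry-free, from the tree's
`Literature.NumberTheory.QuadraticFields.Quadratic.exists_prime_prescribed_residues`
(CRT + Dirichlet) and `WeierstrassCurve.conductorNorm_pos_holds` (`N_E ≠ 0`, which the clause
`¬ D ∣ N_E` silently needs), plus Mathlib's `jacobiSym.mod_left'` / `jacobiSym.one_left` /
`ZMod.nonsquare_iff_jacobiSym_eq_neg_one`.

The two `def`s are VERBATIM copies of the line's `LowerChamberDoor.IsDefConfig` /
`LowerChamberDoor.DefFieldStatement` (the `Cruxes/…/Lines` module is not an importable olean on the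
farm — `remote:stale:unbuilt` — so the statement is re-declared byte-for-byte in a triage namespace;
a by-name discharge is then `exact TriageR11.defFieldStatement_holds` once the line is registered /
the defs move to a Theorems file).

CONSEQUENCE FOR CRUX-PLAN (sharpen 2 of TRIAGE-r1-1, now kernel-certified): `stub_defField` is
SUPPORT, size S, born closed; it is not a crux of the line and carries no (cp)/(tr) clause
(gen-6 resolution: `IsDefConfig` stays class-number-free). Nothing here touches the engine
`stub_lowerChamber`, the crux, the route or BSD.
-/

set_option autoImplicit false
set_option linter.dupNamespace false

noncomputable section

open scoped Classical

open WeierstrassCurve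

namespace Summit.BirchSwinnertonDyer.BirchSwinnertonDyer.Cruxes.KobayashiLowerHalfLargeImage.TriageR11

/-- VERBATIM copy of `LowerChamberDoor.IsDefConfig` (`Lines/lower_chamber_door.lean` l.57–60):
the (def) configuration for `L = ℚ(√-D)` relative to `(W, p, ℓ)`. -/
def IsDefConfig (W : WeierstrassCurve ℚ) [W.IsElliptic] (p ℓ D : ℕ) : Prop :=
  D.Prime ∧ D % 8 = 7 ∧ D ≠ p ∧ D ≠ ℓ ∧ ¬ (D ∣ W.conductorNorm ℤ) ∧
    jacobiSym (-(D : ℤ)) p = 1 ∧ jacobiSym (-(D : ℤ)) ℓ = -1 ∧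
    ∀ r : ℕ, r.Prime → r ≠ 2 → r ≠ ℓ → r ∣ W.conductorNorm ℤ → jacobiSym (-(D : ℤ)) r = 1

/-- VERBATIM copy of `LowerChamberDoor.DefFieldStatement` (`Lines/lower_chamber_door.lean`
l.72–74): for distinct odd primes `p, ℓ` a (def)-configured prime `D` exists. -/
def DefFieldStatement : Prop :=
  ∀ (W : WeierstrassCurve ℚ) [W.IsElliptic] (p ℓ : ℕ), p.Prime → ℓ.Prime → p ≠ 2 → ℓ ≠ 2 → p ≠ ℓ →
    ∃ D : ℕ, IsDefConfig W p ℓ D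

/-- Residue bookkeeping: if `r ≡ -1 (mod s)` then `J(-r | s) = J(1 | s) = 1`. -/
theorem jacobiSym_neg_eq_one_of_cast_eq_neg_one {r s : ℕ} (h : (r : ZMod s) = -1) :
    jacobiSym (-(r : ℤ)) s = 1 := by
  have h1 : ((-(r : ℤ) : ℤ) : ZMod s) = ((1 : ℤ) : ZMod s) := by
    rw [Int.cast_neg, Int.cast_natCast, Int.cast_one, h, neg_neg]
  rw [ZMod.intCast_eq_intCast_iff'] at h1
  rw [jacobiSym.mod_left' h1, jacobiSym.one_left]

/-- Residue bookkeeping at the inert prime: if `-r` is a non-square mod the prime `ℓ` then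
`J(-r | ℓ) = -1`. -/
theorem jacobiSym_neg_eq_neg_one_of_not_isSquare {r ℓ : ℕ} (hℓ : ℓ.Prime)
    (h : ¬ IsSquare (-(r : ZMod ℓ))) : jacobiSym (-(r : ℤ)) ℓ = -1 := by
  haveI : Fact ℓ.Prime := ⟨hℓ⟩
  rw [ZMod.nonsquare_iff_jacobiSym_eq_neg_one, Int.cast_neg, Int.cast_natCast]
  exact h

/-- **`stub_defField` discharged.** For an elliptic `W/ℚ` and distinct odd primes `p, ℓ` there is a
prime `D ≡ 7 (mod 8)`, `D ∉ {p, ℓ}`, `D ∤ N_E`, with `(-D/p) = 1`, `(-D/ℓ) = -1` and `(-D/r) = 1` at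
every odd prime `r ≠ ℓ` of the conductor. Proof: apply `exists_prime_prescribed_residues` to the
split set `S = ({p} ∪ primes(N_E)) \ {ℓ}` and the inert set `{ℓ}` beyond the bound `N_E + p + ℓ`
(`N_E ≠ 0` by `conductorNorm_pos_holds`); the prime `D = r` it returns has `r ≡ 7 (mod 8)`,
`r ≡ -1 (mod s)` for odd `s ∈ S` (so `J(-r | s) = 1`) and `-r` a non-residue mod `ℓ`. -/
theorem defFieldStatement_holds : DefFieldStatement := by
  intro W _ p ℓ hp hℓ hp2 hℓ2 hpℓ
  classical
  have hN0 : W.conductorNorm ℤ ≠ 0 := (W.conductorNorm_pos_holds).ne'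
  set N : ℕ := W.conductorNorm ℤ with hN
  set S : Finset ℕ := (insert p N.primeFactors).erase ℓ with hS_def
  have hS : ∀ s ∈ S, s.Prime := by
    intro s hs
    rw [hS_def, Finset.mem_erase, Finset.mem_insert] at hs
    rcases hs.2 with h | h
    · exact h ▸ hp
    · exact Nat.prime_of_mem_primeFactors h
  have hT : ∀ q ∈ ({ℓ} : Finset ℕ), q.Prime := by
    intro q hq
    rw [Finset.mem_singleton] at hq
    exact hq ▸ hℓ
  have hST : Disjoint S ({ℓ} : Finset ℕ) := by
    rw [Finset.disjoint_singleton_right, hS_def]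
    exact Finset.notMem_erase ℓ _
  obtain ⟨r, hr, hrn, -, -, -, h8, -, hSres, hTres⟩ :=
    Literature.NumberTheory.QuadraticFields.Quadratic.exists_prime_prescribed_residues S {ℓ} hS hT
      hST (N + p + ℓ)
  have h2T : (2 : ℕ) ∉ ({ℓ} : Finset ℕ) := by
    rw [Finset.mem_singleton]
    exact fun h ↦ hℓ2 h.symm
  refine ⟨r, hr, h8 h2T, by omega, by omega, ?_, ?_, ?_, ?_⟩
  · -- `D ∤ N_E`: `D` is a prime beyond `N_E ≥ 1`
    intro h
    have := Nat.le_of_dvd (Nat.pos_of_ne_zero hN0) h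
    omega
  · -- `p` split: `p ∈ S` is odd, so `r ≡ -1 (mod p)` and `J(-r | p) = 1`
    have hpS : p ∈ S := by
      rw [hS_def, Finset.mem_erase]
      exact ⟨hpℓ, Finset.mem_insert_self _ _⟩
    exact jacobiSym_neg_eq_one_of_cast_eq_neg_one (hSres p hpS hp2)
  · -- `ℓ` inert: `-r` is a non-residue mod `ℓ`
    exact jacobiSym_neg_eq_neg_one_of_not_isSquare hℓ
      (hTres ℓ (Finset.mem_singleton_self ℓ) hℓ2).2
  · -- every other odd prime of the conductor split
    intro s hs hs2 hsℓ hsN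
    have hsS : s ∈ S := by
      rw [hS_def, Finset.mem_erase, Finset.mem_insert, Nat.mem_primeFactors]
      exact ⟨hsℓ, Or.inr ⟨hs, hsN, hN0⟩⟩
    exact jacobiSym_neg_eq_one_of_cast_eq_neg_one (hSres s hsS hs2)

end Summit.BirchSwinnertonDyer.BirchSwinnertonDyer.Cruxes.KobayashiLowerHalfLargeImage.TriageR11

end
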